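import Summits.HodgeConjecture.HodgeConjecture.Theses.GmtVisibleFractionBootstrap
import HarnessLib

/-!
# Assembly of route `GmtVisibleFractionBootstrap` (stmt-HodgeConjecture-18337)

The assembly item of route `GmtVisibleFractionBootstrap` is, verbatim, the curried form of the route file's
deciding theorem `closes` (sorry-free in `Theses/GmtVisibleFractionBootstrap.lean`, where the assembly is proved
inline: lower half `2p ≤ n` by Lawson's ballast plus the positive case on the model of `SetupExists`, upper half by
hard Lefschetz); this file records it as a theorem so the item closes. No mathematics beyond the route file's own
`closes`.
-/

set_option linter.dupNamespace false

namespace Summit.HodgeConjecture.HodgeConjecture.Theorems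

/-- **Assembly of route `GmtVisibleFractionBootstrap`** (item stmt-HodgeConjecture-18337):
`VisibleFraction → RemainderPositivity → FreeCycles → ConvexBootstrap → BootstrapOfCruxes → LawsonBallast →
SetupExists → PolarisedLefschetzData → HodgeConjecture`, exactly as composed by the route file's deciding theorem
`Summit.HodgeConjecture.HodgeConjecture.Theses.GmtVisibleFractionBootstrap.closes`, of which this is the curried
restatement. -/
theorem gmtVisibleFractionBootstrap_assembly_proof :
    Summit.HodgeConjecture.HodgeConjecture.Theses.GmtVisibleFractionBootstrap.Assembly :=
  fun vf rp fc cb boot lb se pl ↦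
    Summit.HodgeConjecture.HodgeConjecture.Theses.GmtVisibleFractionBootstrap.closes vf rp fc cb boot lb se pl

end Summit.HodgeConjecture.HodgeConjecture.Theorems
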